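import Mathlib
import Summits.Ventures.PercRepro2.HCov
import Summits.Ventures.PercRepro2.RootLeafUHalf
import Summits.Ventures.PercRepro2.RootLeafUOu
import Summits.Ventures.PercRepro2.RootLeafUClaimI
import Summits.Ventures.PercRepro2.RootLeafULSide
import Summits.Ventures.PercRepro2.RootLeafULSideAssoc
import Summits.Ventures.PercRepro2.RootLeafULSidePD
import Summits.Ventures.PercRepro2.RootLeafULSideHalfII
import Summits.Ventures.PercRepro2.RootLeafULSideHalves

/-!
# The `o ∈ L` half of W1 on the `K5_L`-class, modulo the `b ∈ K` half `(I′)` of the four-mark claim (blind cell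
PercRepro2, p4 g30; S3 (G4-u) item (ap), proofs/P4-G30-HALVES.md §3)

`LSidePD.T2oL_nonneg_of_m2_K5L` (RootLeafULSidePD) with its hypothesis `(m2)` replaced by the `b ∈ K` half `(I′)`,
through `LSideII.m2_nonneg_of_halfIp` (RootLeafULSideHalves: `(m2) = (II) + (I′)` and the theorem `halfII`).
-/

namespace Summit.Ventures.PercRepro2

open UnionCluster CovForm

namespace RootLeafU

namespace LSideII

variable {V : Type*} {E : Type*} [Fintype E] [DecidableEq E] [Fintype V] [DecidableEq V]
  {R : Type*} [Field R] [LinearOrder R] [IsStrictOrderedRing R]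

variable (p : E → R) (ends : E → Sym2 V) (o a₂ c b u : V)

/-- **`0 ≤ T2oL` on the `K5_L`-class, modulo the `b ∈ K` half `(I′)` of the four-mark claim** (`D > 0`). -/
theorem T2oL_nonneg_of_Ip_K5L (hp : IsProbVec p) (hD : 0 < prob p (PDEvent ends u a₂ c))
    (hIp : 0 ≤ 2 * prob p (PDEvent ends u a₂ c) * (prob p (PDEvent ends u a₂ c) + prob p (TEvent ends a₂ u c)) * ((prob p (PDEvent ends u a₂ c) + prob p (TEvent ends u a₂ c)) * prob p (connEvent ends a₂ b) - (prob p (PDEvent ends u a₂ c ∩ connEvent ends a₂ b) + prob p (TEvent ends u a₂ c ∩ connEvent ends a₂ b))) + 2 * prob p (PDEvent ends u a₂ c) * (1 - prob p (avoidAll ends a₂ {c})) * (prob p (TEvent ends a₂ u c) * (prob p (PDEvent ends u a₂ c ∩ connEvent ends a₂ b) + prob p (TEvent ends u a₂ c ∩ connEvent ends a₂ b)) - (prob p (PDEvent ends u a₂ c) + prob p (TEvent ends u a₂ c)) * prob p (TEvent ends a₂ u c ∩ connEvent ends a₂ b)) - (prob p (PDEvent ends u a₂ c) + prob p (avoidAll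 ends a₂ {c}) * prob p (avoidAll ends a₂ {u})) * (prob p (TEvent ends u a₂ c) * prob p (PDEvent ends u a₂ c ∩ connEvent ends u b) - prob p (PDEvent ends u a₂ c) * prob p (TEvent ends u a₂ c ∩ connEvent ends u b)))
    (hK5L : 0 ≤ prob p (PDEvent ends u a₂ c ∩ connEvent ends u b) * (prob p (TEvent ends u a₂ c) * prob p (PDEvent ends u a₂ c ∩ connEvent ends u o) - prob p (PDEvent ends u a₂ c) * prob p (TEvent ends u a₂ c ∩ connEvent ends u o)) + prob p (PDEvent ends u a₂ c) * ((prob p (PDEvent ends u a₂ c) + prob p (TEvent ends u a₂ c)) * prob p (TEvent ends u a₂ c ∩ (connEvent ends u o ∩ connEvent ends u b)) - (prob p (PDEvent ends u a₂ c ∩ connEvent ends u o) + prob p (TEvent ends u a₂ c ∩ connEvent ends u o)) * prob p (TEvent ends u a₂ c ∩ connEvent ends u b))) :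
    0 ≤ T2oL p ends o a₂ c b u :=
  LSidePD.T2oL_nonneg_of_m2_K5L p ends o a₂ c b u hp hD (m2_nonneg_of_halfIp p ends a₂ c b u hp hIp) hK5L

end LSideII

end RootLeafU

end Summit.Ventures.PercRepro2
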